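import Literature.Topology.FourManifolds.TorusSurgery
import HarnessLib

/-!
# Dehn surgery along the unknotted torus in `S⁴`: the Clifford torus, unknotted `T²`-knots, and
# Montesinos' rigidity theorem (named fact)

Topic `Literature/Topology/FourManifolds`. Fact request of crux item stmt-SmoothPoincare4-18529
(route SmoothPoincare4/SblfDescent, decl `Summit.SmoothPoincare4.SmoothPoincare4.Theses.SblfDescent.StepTwo`,
line `Sketch`, stub `stub_montesinosRigidity`), stated over the tree's
`Literature.Topology.FourManifolds.IsTorusLinkSurgery` (torus surgery = Dehn surgery along framed
tori in `S⁴`, `TorusSurgery.lean`).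

## Content

* `cliffordTorusFour` — the standard unknotted torus in `S⁴`: the Clifford torus
  `{x₄ = 0, x₀² + x₁² = 1/2, x₂² + x₃² = 1/2}` of the equatorial `S³ = S⁴ ∩ {x₄ = 0}` of Mathlib's
  unit sphere `S⁴ ⊆ ℝ⁵`; `mem_cliffordTorusFour_iff` (`Iff.rfl`), `cliffordTorusFour_nonempty`
  (the point `(1/2, 1/2, 1/2, 1/2, 0)`, proved).
* `IsUnknottedTorus S` — the subset `S ⊆ S⁴` is an UNKNOTTED torus: some self-diffeomorphism of `S⁴`
  carries `S` onto `cliffordTorusFour` (Iwase 1988, Def. 2.1: equivalence of `T²`-knots = ambient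
  diffeomorphism; Def. 2.2: unknotted = bounds a solid torus, "any two unknotted `T²`-knots are
  equivalent"); `isUnknottedTorus_iff` (`Iff.rfl` against the literal set-builder block inlined in
  the crux skeleton), `isUnknottedTorus_cliffordTorusFour`, `IsUnknottedTorus.image` (proved).
* NAMED FACT `nonempty_diffeomorph_sphere_four_of_torusSurgery_unknotted` — Montesinos 1983 (p. 187),
  as quoted by Iwase 1988 (p. 294): a homotopy 4-sphere obtained by Dehn surgery along an unknotted
  `T²`-knot in `S⁴` is diffeomorphic to `S⁴`. Rendered: if `X` is a torus surgery on `S⁴` along ONE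
  framed torus `T` with any regluing matrix `A ∈ GL(3,ℤ)`
  (`IsTorusLinkSurgery (𝓡 4) X 1 (fun _ => T) (fun _ => A)`), the core `T (T² × 0)` is unknotted
  (`IsUnknottedTorus`), and `X ≃ₕ S⁴`, then `X ≅ S⁴`.

## Sources (what was page-checked)

* Z. Iwase, *Dehn-surgery along a torus T²-knot*, Pacific J. Math. 133 (1988) 289–299,
  doi:10.2140/pjm.1988.133.289 — READ in the literature store
  (`paper:iwase1988-dehn-surgery-along-torus-i-t-i`, pp. 289–291, 294–296, 299): §1 p. 289
  (*"Another 4-dimensional version is Dehn-surgery along a 2-torus embedded in `S⁴` [7], which we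
  call a `T²`-knot in this paper. In this version, `N = T² × D²` and `π₀ Diff ∂N = GL₃ℤ`."*);
  Def. 2.1 and Def. 2.2 p. 291 (quoted in the docstring of `IsUnknottedTorus`); Def. 3.2 p. 294
  (Dehn surgery of type `(α, β, γ)`); p. 294 (the Montesinos quote, verbatim in the docstring of
  the fact); p. 295 (*"Note that the diffeomorphism type of `M` is determined by `K` and
  `i ∘ h(m)`"*, *"Dehn-surgery along any `T²`-knot can be defined in the same way"*); reference
  list p. 299 (`[7]` = Montesinos 1983, `[9]` = Pao 1977).
* J. M. Montesinos, *On twins in the four-sphere I*, Quart. J. Math. Oxford Ser. (2) 34 (1983),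
  no. 134, 171–199, doi:10.1093/qmath/34.2.171, p. 187 — NOT held (paywalled; acquisition request
  acq-06888 open); cited THROUGH Iwase's verbatim quote.
* P. S. Pao, *The topological structure of 4-manifolds with effective torus actions. I*, Trans.
  Amer. Math. Soc. 227 (1977) 279–317 (Iwase's `[9]`: the list containing all Dehn surgeries on
  the unknotted torus) — not used formally.
* K. Larson, *Surgery on tori in the 4-sphere* (2018), §2 (torus surgery and `GL(3,ℤ)`; the
  source of `IsTorusLinkSurgery`).

## Design choices and wording risks

* **"Unknotted" is read as "equivalent to the standard torus".** Iwase's Def. 2.2 defines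
  unknotted as "bounds a solid torus `S¹ × D²` in `S⁴`" and records "any two unknotted `T²`-knots
  are equivalent" (equivalence = ambient diffeomorphism of `S⁴`, Def. 2.1). The Clifford torus
  bounds the solid torus `{x₄ = 0, x₀² + x₁² ≤ 1/2} ∩ S⁴ ≅ D² × S¹` inside the equatorial `S³`, so
  it is unknotted in Iwase's sense, and by Iwase's remark a torus is unknotted iff it is equivalent
  to the Clifford torus; conversely a torus carried onto the Clifford torus by `Ψ` bounds
  `Ψ⁻¹`(that solid torus). `IsUnknottedTorus` takes the "equivalent to `cliffordTorusFour`" form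
  as THE definition (it is the form the consuming skeleton inlines, and it avoids a separate
  solid-torus-embedding vocabulary). WORDING RISK: the equivalence of the two forms rests on
  Iwase's unproved-here remark; a reader wanting Def. 2.2 literally must supply it.
* **Dehn surgery = `IsTorusLinkSurgery` with one torus.** Iwase's Def. 3.2 / §1: remove
  `N(K) ≅ T² × D²`, reglue by `h ∈ Diff ∂N(K)`, `π₀ Diff T³ = GL₃ℤ`; the result depends only on
  `K` and the isotopy class (indeed only on `i ∘ h(m)`, p. 295). `IsTorusLinkSurgery (𝓡 4) X 1
  (fun _ => T) (fun _ => A)` is exactly this with the regluing the LINEAR representative `ψ_A` of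
  the class `A ∈ GL(3,ℤ)` (open-gluing form, framing absorbed into `T`), so every Dehn surgery in
  Iwase's sense is, up to diffeomorphism, an instance and conversely; "obtained by" = "diffeomorphic
  to the result" is absorbed by the transport-invariant relational predicate, as in
  `Iwase1988_gluckTwist_isTorusLinkSurgery`.
* **Category / closedness.** Montesinos and Iwase work with closed smooth 4-manifolds; an `X` with
  `IsTorusLinkSurgery (𝓡 4) X 1 _ _` that is Hausdorff and second countable is the closed smooth
  result of the surgery. "Homotopy 4-sphere" is read as `X ≃ₕ S⁴` (Mathlib
  `ContinuousMap.HomotopyEquiv`), the reading used throughout route SmoothPoincare4; the conclusion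
  is an unoriented `C^∞` diffeomorphism onto Mathlib's unit sphere `S⁴ ⊆ ℝ⁵` (stereographic
  structure), the model of `S⁴` used by every `S⁴`-fact of this directory.
* **Shape.** The fact quantifies over `X : Type` (universe `0`), exactly as the sibling facts
  `nonempty_diffeomorph_sphere_four_of_sblf_genus_one(_noLefschetz)` consumed by the same route, and
  its body is, after unfolding `IsUnknottedTorus` and `cliffordTorusFour`, LITERALLY the registered
  stub `stub_montesinosRigidity` of the skeleton (checked: the stub follows from `(h : fact)` by
  `fun X _ _ _ _ _ T A hs hu e => h X T A hs hu e`).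
* Degenerate cases: `A = 1` (trivial surgery) gives back `S⁴`, consistent; the hypothesis is not
  vacuous (`S⁴` with the Clifford framed torus and `A = 1` is an instance, cf.
  `IsTorusLinkSurgery.nonempty`, `isUnknottedTorus_cliffordTorusFour`). SPC4 is not smuggled in: the
  statement is restricted to ONE UNKNOTTED torus, where it is Montesinos' published theorem (for
  knotted tori or links it is open, cf. route item `LinkSurgeryPropertyP`).
-/

open scoped Manifold ContDiff Topology ContinuousMap
open Function Set

noncomputable section

namespace Literature.Topology.FourManifolds

/-! ## The Clifford torus and unknotted tori in `S⁴` -/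

/-- **The Clifford torus in `S⁴`**, the standard unknotted `T²`-knot: the torus
`{x₄ = 0, x₀² + x₁² = 1/2, x₂² + x₃² = 1/2}` in Mathlib's unit sphere `S⁴ ⊆ ℝ⁵`, i.e. the Clifford
torus of the equatorial `S³ = S⁴ ∩ {x₄ = 0}`. It bounds the solid torus
`{x₄ = 0, x₀² + x₁² ≤ 1/2} ∩ S⁴ ≅ D² × S¹` in `S⁴`, so it is unknotted in the sense of Iwase 1988,
Def. 2.2 (*"A `T²`-knot `K` in `S⁴` is called unknotted if `K` bounds a solid torus `S¹ × D²` in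
`S⁴`."*). [cite: Iwase1988, Def. 2.2 (p. 291)] -/
def cliffordTorusFour : Set ↥(Metric.sphere (0 : EuclideanSpace ℝ (Fin 5)) 1) :=
  {x | (x : EuclideanSpace ℝ (Fin 5)) 4 = 0 ∧
    (x : EuclideanSpace ℝ (Fin 5)) 0 ^ 2 + (x : EuclideanSpace ℝ (Fin 5)) 1 ^ 2 = 1 / 2 ∧
    (x : EuclideanSpace ℝ (Fin 5)) 2 ^ 2 + (x : EuclideanSpace ℝ (Fin 5)) 3 ^ 2 = 1 / 2}

/-- Membership in the Clifford torus, unfolded (definitional). [folklore] -/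
theorem mem_cliffordTorusFour_iff (x : ↥(Metric.sphere (0 : EuclideanSpace ℝ (Fin 5)) 1)) :
    x ∈ cliffordTorusFour ↔
      (x : EuclideanSpace ℝ (Fin 5)) 4 = 0 ∧
      (x : EuclideanSpace ℝ (Fin 5)) 0 ^ 2 + (x : EuclideanSpace ℝ (Fin 5)) 1 ^ 2 = 1 / 2 ∧
      (x : EuclideanSpace ℝ (Fin 5)) 2 ^ 2 + (x : EuclideanSpace ℝ (Fin 5)) 3 ^ 2 = 1 / 2 :=
  Iff.rfl

/-- The Clifford torus is non-empty: it contains the point `(1/2, 1/2, 1/2, 1/2, 0)` of `S⁴`.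
[folklore] -/
theorem cliffordTorusFour_nonempty : cliffordTorusFour.Nonempty := by
  refine ⟨⟨!₂[1 / 2, 1 / 2, 1 / 2, 1 / 2, 0], ?_⟩, ?_⟩
  · -- `(1/2)² · 4 + 0² = 1`
    rw [Metric.mem_sphere, dist_zero_right, EuclideanSpace.norm_eq, Real.sqrt_eq_one,
      Fin.sum_univ_five]
    simp only [Fin.isValue, Matrix.cons_val_zero, Matrix.cons_val_one, Matrix.cons_val]
    norm_num
  · -- `x₄ = 0`, `(1/2)² + (1/2)² = 1/2` twice
    simp only [mem_cliffordTorusFour_iff, Fin.isValue, Matrix.cons_val_zero, Matrix.cons_val_one,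
      Matrix.cons_val]
    norm_num

/-- **Unknotted tori in `S⁴`.** The subset `S ⊆ S⁴` is an unknotted torus if some
self-diffeomorphism `Ψ` of `S⁴` carries it onto the Clifford torus: `Ψ '' S = cliffordTorusFour`.
Iwase 1988, Def. 2.1, verbatim: *"A submanifold `K` in `Mⁿ` is called an `Nⁿ⁻²`-knot in `Mⁿ` if
`K` is diffeomorphic to `Nⁿ⁻²`. Let `K`, `K₁` be two `Nⁿ⁻²`-knots in `Mⁿ`. `K` and `K₁` are
equivalent if there exists a diffeomorphism `h : (Mⁿ, K) → (Mⁿ, K₁)`"*; Def. 2.2, verbatim: *"A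
`T²`-knot `K` in `S⁴` is called unknotted if `K` bounds a solid torus `S¹ × D²` in `S⁴`. Any two
unknotted `T²`-knots are equivalent."* LEAN READING: "unknotted" is taken to mean "equivalent
(Def. 2.1: ambient self-diffeomorphism of `S⁴`) to the standard unknotted torus
`cliffordTorusFour`"; by Iwase's remark and the fact that the Clifford torus bounds the solid
torus `{x₄ = 0, x₀² + x₁² ≤ 1/2} ∩ S⁴`, this is equivalent to Def. 2.2 as printed (a wording
choice, flagged in the module docstring). [cite: Iwase1988, Def. 2.1, Def. 2.2 (p. 291)] -/
def IsUnknottedTorus (S : Set ↥(Metric.sphere (0 : EuclideanSpace ℝ (Fin 5)) 1)) : Prop :=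
  ∃ Ψ : Diffeomorph (𝓡 4) (𝓡 4) ↥(Metric.sphere (0 : EuclideanSpace ℝ (Fin 5)) 1)
      ↥(Metric.sphere (0 : EuclideanSpace ℝ (Fin 5)) 1) ((⊤ : ℕ∞) : WithTop ℕ∞),
    Ψ '' S = cliffordTorusFour

/-- Unfolding of `IsUnknottedTorus` into the literal block inlined in the stubs of crux
stmt-SmoothPoincare4-18529 (skeleton `Cruxes/StepTwo/Lines/Sketch.lean`): definitional,
`Iff.rfl`. [folklore] -/
theorem isUnknottedTorus_iff (S : Set ↥(Metric.sphere (0 : EuclideanSpace ℝ (Fin 5)) 1)) :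
    IsUnknottedTorus S ↔
      ∃ Ψ : Diffeomorph (𝓡 4) (𝓡 4) ↥(Metric.sphere (0 : EuclideanSpace ℝ (Fin 5)) 1)
          ↥(Metric.sphere (0 : EuclideanSpace ℝ (Fin 5)) 1) ((⊤ : ℕ∞) : WithTop ℕ∞),
        Ψ '' S =
          {x : ↥(Metric.sphere (0 : EuclideanSpace ℝ (Fin 5)) 1) |
            (x : EuclideanSpace ℝ (Fin 5)) 4 = 0 ∧
            (x : EuclideanSpace ℝ (Fin 5)) 0 ^ 2 + (x : EuclideanSpace ℝ (Fin 5)) 1 ^ 2 = 1 / 2 ∧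
            (x : EuclideanSpace ℝ (Fin 5)) 2 ^ 2 + (x : EuclideanSpace ℝ (Fin 5)) 3 ^ 2 = 1 / 2} :=
  Iff.rfl

/-- The Clifford torus itself is unknotted (take `Ψ = id`). [folklore] -/
theorem isUnknottedTorus_cliffordTorusFour : IsUnknottedTorus cliffordTorusFour :=
  ⟨Diffeomorph.refl _ _ _, by rw [Diffeomorph.coe_refl, Set.image_id]⟩

/-- Unknottedness is invariant under self-diffeomorphisms of `S⁴`: if `S` is unknotted, so is
`Φ '' S` (compose with `Φ⁻¹`). [folklore] -/
theorem IsUnknottedTorus.image {S : Set ↥(Metric.sphere (0 : EuclideanSpace ℝ (Fin 5)) 1)}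
    (h : IsUnknottedTorus S)
    (Φ : Diffeomorph (𝓡 4) (𝓡 4) ↥(Metric.sphere (0 : EuclideanSpace ℝ (Fin 5)) 1)
      ↥(Metric.sphere (0 : EuclideanSpace ℝ (Fin 5)) 1) ((⊤ : ℕ∞) : WithTop ℕ∞)) :
    IsUnknottedTorus (Φ '' S) := by
  obtain ⟨Ψ, hΨ⟩ := h
  refine ⟨Φ.symm.trans Ψ, ?_⟩
  rw [Diffeomorph.coe_trans, Set.image_comp, ← Set.image_comp Φ.symm, ← hΨ]
  congr 1
  ext x
  simp

/-! ## Montesinos: homotopy 4-spheres from Dehn surgery on the unknotted torus are standard -/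

/-- **Montesinos 1983 — rigidity of Dehn surgery along the unknotted torus** (NAMED FACT, not
proved here). Iwase 1988, p. 294, verbatim: *"Montesinos showed that any homotopy 4-sphere
obtained by Dehn-surgery along an unknotted `T²`-knot in `S⁴` is diffeomorphic to `S⁴` (see [7],
p. 187). Pao studied the 4-manifolds with effective `T²`-action in [9]. All the 4-manifolds
obtained by Dehn-surgeries along an unknotted `T²`-knot are contained in his list."* (`[7]` =
J. M. Montesinos, *On twins in the four-sphere I*, Quart. J. Math. Oxford (2) 34 (1983) 171–199;
`[9]` = Pao 1977.) The operation, Iwase 1988 §1 (p. 289): *"Dehn-surgery along a 2-torus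
embedded in `S⁴` [7], which we call a `T²`-knot in this paper. In this version, `N = T² × D²` and
`π₀ Diff ∂N = GL₃ℤ`"*, and Def. 3.2 (p. 294): *"`N(K)` is diffeomorphic to `T² × D²`. Let
`i : ∂N(K) → ∂(S⁴ - Int N(K))` be the natural identification and `h : ∂N(K) → ∂N(K)` be a
diffeomorphism such that `i ∘ h(m) = αm + βl₁ + γl₂`. `M = S⁴ - N(K) ∪_{i∘h} N(K)` is called the
manifold obtained by Dehn-surgery of type `(α, β, γ)` along `K`"* (p. 295: *"Dehn-surgery along
any `T²`-knot can be defined in the same way"*). In the tree this operation is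
`IsTorusLinkSurgery (𝓡 4) X 1 (fun _ => T) (fun _ => A)` (`TorusSurgery.lean`): `X` is the open
gluing of the complement of the core torus `T (T² × 0)` of the framed tube
`T : (S¹ × S¹) × ℝ² → S⁴` with `(S¹ × S¹) × ℝ²` along the linear regluing `ψ_A`,
`A ∈ GL(3,ℤ) = π₀ Diff T³`. LEAN READING: for every Hausdorff second-countable `C^∞` 4-manifold
`X : Type` (charted on `EuclideanSpace ℝ (Fin 4)`), every framed tube `T` and every
`A : Matrix (Fin 3) (Fin 3) ℤ`, if `IsTorusLinkSurgery (𝓡 4) X 1 (fun _ => T) (fun _ => A)` (one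
torus, any regluing), the core torus `Set.range (fun x => T (x, 0))` is unknotted
(`IsUnknottedTorus`: carried onto the Clifford torus `cliffordTorusFour` of the equatorial `S³` by
a self-diffeomorphism of `S⁴`; Iwase Def. 2.2), and `X ≃ₕ S⁴` (homotopy 4-sphere), then `X` is
diffeomorphic to the unit sphere `S⁴ ⊆ ℝ⁵`. "Obtained by Dehn surgery" = "diffeomorphic to the
result" is absorbed by the transport-invariant relational predicate; Iwase's `h ∈ Diff T³` may be
taken linear since the result depends only on its isotopy class (p. 295). After unfolding
`IsUnknottedTorus` this is literally the stub `stub_montesinosRigidity` of crux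
stmt-SmoothPoincare4-18529, line `Sketch`. Users take
`(h : nonempty_diffeomorph_sphere_four_of_torusSurgery_unknotted)`; nothing is asserted.
[cite: Montesinos1983, p. 187] [cite: Iwase1988, p. 294 (quoting Montesinos), Def. 2.2, Def. 3.2] -/
def nonempty_diffeomorph_sphere_four_of_torusSurgery_unknotted : Prop :=
  ∀ (X : Type) [TopologicalSpace X] [T2Space X] [SecondCountableTopology X]
    [ChartedSpace (EuclideanSpace ℝ (Fin 4)) X] [IsManifold (𝓡 4) ((⊤ : ℕ∞) : WithTop ℕ∞) X]
    (T : (↥(Metric.sphere (0 : EuclideanSpace ℝ (Fin 2)) 1) ×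
        ↥(Metric.sphere (0 : EuclideanSpace ℝ (Fin 2)) 1)) × EuclideanSpace ℝ (Fin 2) →
      ↥(Metric.sphere (0 : EuclideanSpace ℝ (Fin 5)) 1))
    (A : Matrix (Fin 3) (Fin 3) ℤ),
    IsTorusLinkSurgery (𝓡 4) X 1 (fun _ => T) (fun _ => A) →
    IsUnknottedTorus (Set.range fun x : ↥(Metric.sphere (0 : EuclideanSpace ℝ (Fin 2)) 1) ×
        ↥(Metric.sphere (0 : EuclideanSpace ℝ (Fin 2)) 1) => T (x, 0)) →
    X ≃ₕ Metric.sphere (0 : EuclideanSpace ℝ (Fin 5)) 1 →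
    Nonempty (Diffeomorph (𝓡 4) (𝓡 4) X (Metric.sphere (0 : EuclideanSpace ℝ (Fin 5)) 1)
      ((⊤ : ℕ∞) : WithTop ℕ∞))

-- TODO(general form): Pao 1977 / Iwase 1988 (p. 294) / Larson 2018 §5: the full list of closed
-- 4-manifolds obtained by Dehn surgery on the unknotted torus (`S⁴`, `S¹ × S³ # S² × S²`,
-- `S¹ × S³ # S² ×~ S²`, …, Pao's `L_n`, `L'_n`), once these are objects of the tree; and the
-- equivalence of `IsUnknottedTorus` with Iwase's Def. 2.2 as printed ("bounds a solid torus").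

end Literature.Topology.FourManifolds

end
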